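import Summits.Ventures.PercRepro.Classical
import Summits.Ventures.PercRepro.FaceGrouping

/-!
# PercRepro — Harris–FKG at the class level: Kleitman on every face (typer-2, gen 6)

mine-4's class censuses (bus 10:34:29Z) report that «class-level Harris» — the antipodal-pair form of
`P(A ∩ B) ≥ P(A) P(B)` for increasing `A, B` — is class-positive on every class of every multigraph with
≤ 7 vertices (2,775 up-set pairs). It is a theorem, on every face, by Kleitman's lemma used twice:

* on a cube `Config S`, for increasing `A, B`, the number of `ω` with `ω ∈ A` and `ωᶜ ∈ B` is at most the
  number of `ω ∈ A ∩ B` (**`card_inter_compl_le_card_inter`**): with the uniform measure `p ≡ 1/2`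
  (`weight_half`, `prob_half`), `|A ∩ B̄| / 2ⁿ = P(A ∩ B̄) ≤ P(A) P(B̄) = P(A) P(B) ≤ P(A ∩ B) = |A ∩ B| / 2ⁿ`,
  where `B̄ = {ω | ωᶜ ∈ B}` is a DOWN-set of the same size as `B` (`harris_upper_lower`, `harris`,
  `card_compl_preimage`);
* on a face `[v, u]` of the cube of `E` the events pulled back along `embed` are again increasing
  (`embed_mono`), so **`classHarris`**: for increasing `A, B ⊆ Config E` and every face,
  `#{ρ : embed ρ ∈ A ∧ embed ρᶜ ∈ B} ≤ #{ρ : embed ρ ∈ A ∩ B}` — the class-level antipodal-count form of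
  Harris; **`classHarris_conn`** is the instance for two connection events of a multigraph.

This is the «complementary-pair proof» of Harris the C-024 row asks about: it exists, and it is Kleitman.
-/

namespace PercRepro

open Finset Classical

section Uniform

variable {E : Type*} [Fintype E] [DecidableEq E]

/-- At `p ≡ 1/2` every configuration has the weight `2^{-|E|}`. -/
theorem weight_half (ω : Config E) :
    weight (fun _ : E => (1 / 2 : ℝ)) ω = (1 / 2 : ℝ) ^ Fintype.card E := by
  rw [weight_const]
  have h : (1 : ℝ) - 1 / 2 = 1 / 2 := by norm_num
  rw [h, ← pow_add, Nat.add_sub_cancel' (Finset.card_le_univ _)]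

/-- At `p ≡ 1/2`, `P(A) = |A| · 2^{-|E|}`. -/
theorem prob_half (A : Set (Config E)) [DecidablePred (· ∈ A)] :
    prob (fun _ : E => (1 / 2 : ℝ)) A =
      ((univ.filter (· ∈ A)).card : ℝ) * (1 / 2 : ℝ) ^ Fintype.card E := by
  rw [prob_eq_sum_filter]
  simp only [weight_half, Finset.sum_const, nsmul_eq_mul]

omit [Fintype E] [DecidableEq E] in
/-- `p ≡ 1/2` is a probability vector. -/
theorem isProb_half : IsProb (fun _ : E => (1 / 2 : ℝ)) := fun _ => by norm_num

/-- The complement map is a bijection of the cube: `{ω | ωᶜ ∈ B}` has the size of `B`. -/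
theorem card_compl_preimage (B : Set (Config E)) [DecidablePred (· ∈ B)] :
    (univ.filter fun ω : Config E => ωᶜ ∈ B).card = (univ.filter (· ∈ B)).card := by
  refine Finset.card_bij (fun ω _ => ωᶜ) (fun ω hω => ?_) (fun ω _ ω' _ h => ?_) (fun ω hω => ?_)
  · rw [Finset.mem_filter] at hω
    rw [Finset.mem_filter]
    exact ⟨Finset.mem_univ _, hω.2⟩
  · exact compl_injective h
  · rw [Finset.mem_filter] at hω
    refine ⟨ωᶜ, ?_, compl_compl ω⟩
    rw [Finset.mem_filter, compl_compl]
    exact ⟨Finset.mem_univ _, hω.2⟩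

omit [Fintype E] [DecidableEq E] in
/-- The preimage of an up-set under the complement map is a down-set. -/
theorem isLowerSet_compl_preimage {B : Set (Config E)} (hB : IsUpperSet B) :
    IsLowerSet {ω : Config E | ωᶜ ∈ B} := by
  intro ω ω' hle hω
  exact hB (compl_le_compl hle) hω

/-- **Kleitman on the cube, antipodal form**: for increasing `A, B ⊆ Config E`,
`#{ω : ω ∈ A ∧ ωᶜ ∈ B} ≤ #{ω : ω ∈ A ∧ ω ∈ B}`. -/
theorem card_inter_compl_le_card_inter (A B : Set (Config E)) (hA : IsUpperSet A)
    (hB : IsUpperSet B) :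
    (univ.filter fun ω : Config E => ω ∈ A ∧ ωᶜ ∈ B).card ≤
      (univ.filter fun ω : Config E => ω ∈ A ∧ ω ∈ B).card := by
  set p : E → ℝ := fun _ => (1 / 2 : ℝ) with hp
  have hpos : (0 : ℝ) < (1 / 2 : ℝ) ^ Fintype.card E := by positivity
  -- `P(A ∩ B̄) ≤ P(A) P(B̄)` (`A` up, `B̄` down) and `P(A) P(B) ≤ P(A ∩ B)`.
  have h1 : prob p (A ∩ {ω : Config E | ωᶜ ∈ B}) ≤ prob p A * prob p {ω : Config E | ωᶜ ∈ B} :=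
    harris_upper_lower isProb_half hA (isLowerSet_compl_preimage hB)
  have h2 : prob p A * prob p B ≤ prob p (A ∩ B) := harris isProb_half hA hB
  have h3 : prob p {ω : Config E | ωᶜ ∈ B} = prob p B := by
    rw [prob_half, prob_half]
    congr 2
    exact card_compl_preimage B
  have h4 : prob p (A ∩ {ω : Config E | ωᶜ ∈ B}) =
      ((univ.filter fun ω : Config E => ω ∈ A ∧ ωᶜ ∈ B).card : ℝ) *
        (1 / 2 : ℝ) ^ Fintype.card E := by
    rw [prob_half]
    congr 2
  have h5 : prob p (A ∩ B) =
      ((univ.filter fun ω : Config E => ω ∈ A ∧ ω ∈ B).card : ℝ) *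
        (1 / 2 : ℝ) ^ Fintype.card E := by
    rw [prob_half]
    congr 2
  have key : ((univ.filter fun ω : Config E => ω ∈ A ∧ ωᶜ ∈ B).card : ℝ) *
      (1 / 2 : ℝ) ^ Fintype.card E ≤
      ((univ.filter fun ω : Config E => ω ∈ A ∧ ω ∈ B).card : ℝ) *
        (1 / 2 : ℝ) ^ Fintype.card E := by
    rw [← h4, ← h5]
    calc prob p (A ∩ {ω : Config E | ωᶜ ∈ B}) ≤ prob p A * prob p {ω : Config E | ωᶜ ∈ B} := h1
      _ = prob p A * prob p B := by rw [h3]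
      _ ≤ prob p (A ∩ B) := h2
  exact_mod_cast le_of_mul_le_mul_right key hpos

end Uniform

/-! ### On every face -/

section Face

variable {E : Type*} [Fintype E] [DecidableEq E]

omit [Fintype E] [DecidableEq E] in
/-- The pull-back of an up-set along `embed` is an up-set of the face cube. -/
theorem isUpperSet_preimage_embed {A : Set (Config E)} (hA : IsUpperSet A) (u v : Config E) :
    IsUpperSet {ρ : Config (Face u v) | embed u v ρ ∈ A} := by
  intro ρ ρ' hle hρ
  exact hA (embed_mono u v hle) hρ

/-- **Harris at the class level**: for increasing `A, B ⊆ Config E` and every face `[v, u]` of the cube,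
`#{ρ : embed ρ ∈ A ∧ embed ρᶜ ∈ B} ≤ #{ρ : embed ρ ∈ A ∧ embed ρ ∈ B}` — the antipodal pairs of the face in
`A × B` are at most the points of the face in `A ∩ B`. -/
theorem classHarris (A B : Set (Config E)) (hA : IsUpperSet A) (hB : IsUpperSet B) (u v : Config E) :
    (univ.filter fun ρ : Config (Face u v) => embed u v ρ ∈ A ∧ embed u v ρᶜ ∈ B).card ≤
      (univ.filter fun ρ : Config (Face u v) => embed u v ρ ∈ A ∧ embed u v ρ ∈ B).card :=
  card_inter_compl_le_card_inter {ρ : Config (Face u v) | embed u v ρ ∈ A}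
    {ρ : Config (Face u v) | embed u v ρ ∈ B} (isUpperSet_preimage_embed hA u v)
    (isUpperSet_preimage_embed hB u v)

end Face

namespace MultiGraph

variable {V E : Type*} (G : MultiGraph V E) [Fintype E] [DecidableEq E]

open Classical in
/-- **Class-level Harris for two connection events**: on every face `[v, u]` of the cube of a multigraph,
`#{ρ : a ~ b in embed ρ ∧ c ~ d in embed ρᶜ} ≤ #{ρ : a ~ b ∧ c ~ d in embed ρ}`. -/
theorem classHarris_conn (a b c d : V) (u v : Config E) :
    (univ.filter fun ρ : Config (Face u v) =>
        G.Conn (embed u v ρ) a b ∧ G.Conn (embed u v ρᶜ) c d).card ≤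
      (univ.filter fun ρ : Config (Face u v) =>
        G.Conn (embed u v ρ) a b ∧ G.Conn (embed u v ρ) c d).card :=
  classHarris (G.connEvent a b) (G.connEvent c d) (G.isUpperSet_connEvent a b)
    (G.isUpperSet_connEvent c d) u v

end MultiGraph

end PercRepro
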